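import Mathlib

/-!
# Tier3IsotypicBlock — a Hecke operator on an isotypic block `τ ⊗ M` is `τ(Φ) ⊗ 1`, and its matrix
coefficients against a product pairing factor (T3.5 for T3.1; PERIOD-ADDENDUM-9 §A9.3 step 3)

The doubling method (PERIOD-ADDENDUM-9 §A9.3 step 2) writes the Piatetski-Shapiro–Rallis zeta integral as a
matrix coefficient `Z(s, f₁, f₂, Φ_s, γ_W) = ⟨T_s f₁, f₂⟩` of the operator `T_s = ∫ Φ_s(δ ι(g,1)) R(g) dg`, an
operator in the closed span of the right translations `R(g)`.  Step 3 reads this on a τ-isotypic block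
`τ ⊗ M_τ` of `L²([U(W)])` (`M_τ` the multiplicity space, `R(g) = τ(g) ⊗ 1` on the block): an operator in the
span of the `τ(g) ⊗ 1` is `A ⊗ 1` with `A` in the span of the `τ(g)`, the Hecke operator `Σ Φ(g) · (τ(g) ⊗ 1)`
is `τ(Φ) ⊗ 1`, and for `f₁ = v₁ ⊗ e₁`, `f₂ = v₂ ⊗ e₂` the matrix coefficient against the product pairing
FACTORS: `⟨(A ⊗ 1)(v₁ ⊗ e₁), v₂ ⊗ e₂⟩ = ⟨A v₁, v₂⟩ · ⟨e₁, e₂⟩` — «the step where the copies decouple»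
(§A9.3 Remark (iii)): for `e₁ ⊥ e₂` every such coefficient vanishes.  This file is that linear algebra on the
abstract data — `k` a commutative ring, `τ` and `M` modules, `ρ g : τ →ₗ[k] τ` the block action, the pairing
`B₁.tmul B₂` of Mathlib (`LinearMap.BilinForm.tensorDistrib`), finite sums for the integral (the analytic
closure, the Hilbert direct sum `⊕̂_τ` and `dim M_τ < ∞` stay on the page, labelled CELL / PRINTED there).
No definition, no instance, no notation, `import Mathlib` only.  Nothing here asserts anything about the
original programme; HC_CM is NOT proved by anyone in this repository.
-/

namespace HodgeRepro.T3P1.IsotypicBlock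

open TensorProduct

variable {k : Type*} [CommRing k] {τ M : Type*} [AddCommGroup τ] [Module k τ] [AddCommGroup M] [Module k M]

/-- **The Hecke operator on a block is `τ(Φ) ⊗ 1`.** The finite-sum operator `Σ_g Φ(g) • (ρ g ⊗ 1)` on the
block `τ ⊗ M` equals `(Σ_g Φ(g) • ρ g) ⊗ 1`: the map `A ↦ A ⊗ 1` is linear. -/
theorem rTensor_sum_smul {ι : Type*} (s : Finset ι) (Φ : ι → k) (ρ : ι → τ →ₗ[k] τ) :
    LinearMap.rTensor M (∑ g ∈ s, Φ g • ρ g) = ∑ g ∈ s, Φ g • LinearMap.rTensor M (ρ g) := by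
  have h : ∀ f : τ →ₗ[k] τ, LinearMap.rTensor M f = LinearMap.rTensorHom M f := fun _ => rfl
  simp only [h, map_sum, map_smul]

/-- The span of the block operators `ρ g ⊗ 1` is the image of the span of the `ρ g` under the linear map
`A ↦ A ⊗ 1`. -/
theorem span_range_rTensor {G : Type*} (ρ : G → τ →ₗ[k] τ) :
    Submodule.span k (Set.range fun g => LinearMap.rTensor M (ρ g)) =
      (Submodule.span k (Set.range ρ)).map (LinearMap.rTensorHom M) := by
  rw [← Submodule.span_image]
  congr 1
  exact Set.range_comp' (LinearMap.rTensorHom M) ρ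

/-- **An operator in the span of the `ρ g ⊗ 1` acts on the block as `A ⊗ 1`** for some `A` in the span of
the `ρ g` (§A9.3 step 3: «an operator in the span of the `R(g)` acts on the block as `τ(·) ⊗ 1`»). -/
theorem exists_rTensor_eq_of_mem_span {G : Type*} (ρ : G → τ →ₗ[k] τ)
    {T : τ ⊗[k] M →ₗ[k] τ ⊗[k] M}
    (hT : T ∈ Submodule.span k (Set.range fun g => LinearMap.rTensor M (ρ g))) :
    ∃ A ∈ Submodule.span k (Set.range ρ), T = LinearMap.rTensor M A := by
  rw [span_range_rTensor, Submodule.mem_map] at hT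
  obtain ⟨A, hA, rfl⟩ := hT
  exact ⟨A, hA, rfl⟩

/-- **The matrix coefficient of `A ⊗ 1` against the product pairing factors**:
`⟨(A ⊗ 1)(v₁ ⊗ e₁), v₂ ⊗ e₂⟩ = ⟨A v₁, v₂⟩ · ⟨e₁, e₂⟩` (§A9.3 step 3's display
`Z(s, f₁, f₂, Φ_s, γ_W) = ⟨τ(Φ_s) v₁, v₂⟩_τ · ⟨e₁, e₂⟩_{M_τ}` with `A = τ(Φ_s)`). -/
theorem tmul_rTensor_tmul (B₁ : LinearMap.BilinForm k τ) (B₂ : LinearMap.BilinForm k M)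
    (A : τ →ₗ[k] τ) (v₁ v₂ : τ) (e₁ e₂ : M) :
    (B₁.tmul B₂) (LinearMap.rTensor M A (v₁ ⊗ₜ e₁)) (v₂ ⊗ₜ e₂) = B₁ (A v₁) v₂ * B₂ e₁ e₂ := by
  rw [LinearMap.rTensor_tmul, LinearMap.BilinForm.tensorDistrib_tmul, smul_eq_mul, mul_comm]

/-- The matrix coefficient of the Hecke operator `Σ_g Φ(g) • (ρ g ⊗ 1)` against the product pairing is
`⟨(Σ_g Φ(g) • ρ g) v₁, v₂⟩ · ⟨e₁, e₂⟩`: the zeta integral on the τ-block is the matrix coefficient of `τ(Φ)`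
times the pairing of the multiplicity vectors. -/
theorem tmul_sum_smul_rTensor_tmul {ι : Type*} (s : Finset ι) (Φ : ι → k) (ρ : ι → τ →ₗ[k] τ)
    (B₁ : LinearMap.BilinForm k τ) (B₂ : LinearMap.BilinForm k M) (v₁ v₂ : τ) (e₁ e₂ : M) :
    (B₁.tmul B₂) ((∑ g ∈ s, Φ g • LinearMap.rTensor M (ρ g)) (v₁ ⊗ₜ e₁)) (v₂ ⊗ₜ e₂) =
      B₁ ((∑ g ∈ s, Φ g • ρ g) v₁) v₂ * B₂ e₁ e₂ := by
  rw [← rTensor_sum_smul, tmul_rTensor_tmul]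

/-- **Every operator in the span of the `ρ g ⊗ 1` has factorised matrix coefficients**: there is `A` in the
span of the `ρ g` with `⟨T(v₁ ⊗ e₁), v₂ ⊗ e₂⟩ = ⟨A v₁, v₂⟩ · ⟨e₁, e₂⟩` for all `v₁, v₂, e₁, e₂` — the shape
`S(v₁, v₂) · ⟨e₁, e₂⟩` of PERIOD-ADDENDUM-9 (★), at the level of step 3. -/
theorem exists_forall_tmul_apply_tmul_eq {G : Type*} (ρ : G → τ →ₗ[k] τ)
    (B₁ : LinearMap.BilinForm k τ) (B₂ : LinearMap.BilinForm k M)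
    {T : τ ⊗[k] M →ₗ[k] τ ⊗[k] M}
    (hT : T ∈ Submodule.span k (Set.range fun g => LinearMap.rTensor M (ρ g))) :
    ∃ A ∈ Submodule.span k (Set.range ρ), ∀ (v₁ v₂ : τ) (e₁ e₂ : M),
      (B₁.tmul B₂) (T (v₁ ⊗ₜ e₁)) (v₂ ⊗ₜ e₂) = B₁ (A v₁) v₂ * B₂ e₁ e₂ := by
  obtain ⟨A, hA, rfl⟩ := exists_rTensor_eq_of_mem_span ρ hT
  exact ⟨A, hA, fun v₁ v₂ e₁ e₂ => tmul_rTensor_tmul B₁ B₂ A v₁ v₂ e₁ e₂⟩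

/-- **The copies decouple** (§A9.3 Remark (iii)): if the multiplicity vectors are orthogonal, `⟨e₁, e₂⟩ = 0`,
then every operator in the span of the `ρ g ⊗ 1` has vanishing matrix coefficient between `v₁ ⊗ e₁` and
`v₂ ⊗ e₂`, whatever `v₁, v₂`. -/
theorem tmul_apply_tmul_eq_zero_of_mem_span {G : Type*} (ρ : G → τ →ₗ[k] τ)
    (B₁ : LinearMap.BilinForm k τ) (B₂ : LinearMap.BilinForm k M)
    {T : τ ⊗[k] M →ₗ[k] τ ⊗[k] M}
    (hT : T ∈ Submodule.span k (Set.range fun g => LinearMap.rTensor M (ρ g)))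
    (v₁ v₂ : τ) {e₁ e₂ : M} (he : B₂ e₁ e₂ = 0) :
    (B₁.tmul B₂) (T (v₁ ⊗ₜ e₁)) (v₂ ⊗ₜ e₂) = 0 := by
  obtain ⟨A, -, hA⟩ := exists_forall_tmul_apply_tmul_eq ρ B₁ B₂ hT
  rw [hA, he, mul_zero]

/-- The matrix coefficient of `A ⊗ 1` between `v₁ ⊗ e` and `v₂ ⊗ e` is `⟨A v₁, v₂⟩ · ⟨e, e⟩`: a copy
`τ ⊗ e` with `⟨e, e⟩ ≠ 0` sees the full matrix coefficient of `A` (the «all non-zero as soon as one is» of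
§A9.3 step 4, at the level of step 3). -/
theorem tmul_rTensor_tmul_self (B₁ : LinearMap.BilinForm k τ) (B₂ : LinearMap.BilinForm k M)
    (A : τ →ₗ[k] τ) (v₁ v₂ : τ) (e : M) :
    (B₁.tmul B₂) (LinearMap.rTensor M A (v₁ ⊗ₜ e)) (v₂ ⊗ₜ e) = B₁ (A v₁) v₂ * B₂ e e :=
  tmul_rTensor_tmul B₁ B₂ A v₁ v₂ e e

end HodgeRepro.T3P1.IsotypicBlock
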